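import Summits.QuantumFields.BalabanUV.Beta.D1BFx.PeriodisedProjector
import Summits.QuantumFields.BalabanUV.Beta.D1BFx.TorusTraceTadpole

/-!
# `BalabanUV.Beta.D1BFx.TorusGhostLegs` — road «BF-x» for binder row D1, slot (K), X₃(ii) ROUTE T, brick **K-TB3c PART 1, FILE 1∕2**
# «THE SCALAR GHOST LEGS ON THE TORUS — THE TOWER LEG»: `(Ggh)^` on every fine torus `Site 4 s` (`n ∣ s`) IS the torus inverse of the
# periodised scalar tower operator `Δ^η + a·Q′*Q′` (the LEG LETTER `(AXgh)^·(Ggh)^ = 1 = (Ggh)^·(AXgh)^`, with uniqueness), and its torus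
# one-loop functionals against periodised arrays converge to the `ℤ⁴` ones (the SOCKETS `hessT → hessKer`, TA3b at `F = Unit`).
# FILE 2∕2 = `D1BFx/TorusGhostGram` (the coarse Gram `Q′G′²Q′*` and «the operator C» on the coarse torus).

HONEST DEPENDENCY (cell records, verbatim): «continuum YM on T⁴ ⇐ BetaPertH ∧ nine spine estimates (0/9 proved); BetaPertH ⇐ (D1) ∧ (D4) ∧
CAP+tail; G-an2-4 gates asym, D1 and NE2/3/4.»  HONEST FRAMING (cell contract, verbatim): «discharging `BetaPertH` makes Bałaban's UV stability
UNCONDITIONAL — a real constructive-QFT result; it is NOT the continuum limit and NOT the Clay problem.»  THIS MODULE DISCHARGES NOTHING of (K),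
of D1 or of the wall: [folklore] absolutely convergent lattice bookkeeping over the owner's `PeriodisedProjector` (`Ghat`, `AXhat` — the
unfibred torus letter `Ghat_mul_AXhat` is gen-5's), the D1 typer's `GhostLeg` (`Ggh`, `decays_Ggh`, `shiftK_Ggh`,
`Ggh_symm`, the entrywise dictionary `tsum_AX_mul_Ggh`∕`tsum_Ggh_mul_AX` over pv23's `B5Hk103ScalarZd`), `B5Hk103ScalarZd` (`nbhd`,
`AX_eq_zero_of_not_mem`), leaf-03-g7's `FibredPeriodisation` (`lemma222F`, `eq_periodiseF_of_mul_eq_one(′)`, `periodiseF_transpose`), brick TA2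
`PeriodicArrays` (`arr`, `toF`, `periodic_of_shiftK`) and brick TA3b `TorusTraceTadpole` (`periodiseF_toF_mul_arr`, `tendsto_trace_tadpole∕_bubble`,
`tendsto_hessT_hessKer`) — all USED BY NAME.  One re-indexing definition [our object] (`AXgh`; nothing else is minted — no `def … : Prop`),
nothing cited, 0 sorry.  NOT D1, NOT BetaPertH, NOT continuum, NOT Clay.

ABSOLUTE RULE (cell charter, verbatim): «No internally-minted statement may enter as a cited fact. Every hypothesis is either kernel-proved in this
package or a verbatim quotation of a PUBLISHED theorem with page reference. The manuscript(s) under audit are NOT citable for their own disputed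
steps — they are the thing under adjudication; programme-internal (2001/route/tribunal) claims are never citable.»

WHERE THIS SITS (`HOME/b2b-balaban-beta-d1-p2/K-ASSEMBLY-SPEC-v2.md` v2.2 §2 row K-TB3c «GHOST LEGS ON THE TORUS → ℤ⁴», «OPEN — after K-TB3a»;
`OWNER-MEMO-g6.md` §2).  After K-TB3a (`GhostSplitJets`∕`GhostCompressionJets`, ne9-leaf-02-g25) the ghost side of the owner's DECISION 2 reads, on
every torus, `hessT(Φ_F⁻¹; Φ-jets) = 2·hessT(M̂₀⁻¹; M-jets) + hessT(Ŝ₀⁻¹; S-jets)` with `M₀` the SCALAR TOWER operator `Δ^η + a·Q′*Q′` on fine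
scalar sites and `S₀ = Q′M₀⁻²Q′ᵀ` on coarse sites.  The TB5 assembly therefore needs two torus LEG LETTERS and two `p → ∞` SOCKETS for SCALAR
(`F = Unit`) kernels; the two files supply them (this FILE 1 = §1–§2, FILE 2 `TorusGhostGram` = §3–§4):
* §1 [our object] `AXgh n a` = the site matrix `n²(−Δ) + a·n⁻⁴·1[same n-block]` read as an `MKer 4 Unit` (the operator whose two-sided `ℤ⁴`
  inverse kernel `GhostLeg.Ggh n a` IS); [folklore] `compF (toF AXgh) (toF Ggh) = kdeltaF` (both orders), joint `s`-periodicity of `Ggh` for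
  `n ∣ s`, row bounds, and THE FINE-TORUS LETTER `periodiseF_AXgh_mul_Ggh`: `(AXgh)^·(Ggh)^ = 1 ∧ (Ggh)^·(AXgh)^ = 1` on `Site 4 s × Unit`, with
  the uniqueness corollaries (ANY one-sided torus inverse of `(AXgh)^` is `(Ggh)^`) and the symmetry of `(Ggh)^`.  §1b [folklore] THE
  CURRENCY BRIDGE `periodiseF_Ggh_eq_submatrix`∕`periodiseF_AXgh_eq_submatrix`∕`Ghat_eq_submatrix_periodiseF` (by `rfl`): the fibred matrices
  ARE the owner's unfibred torus matrices `PeriodisedProjector.Ghat (n−1) a s`∕`AXhat (n−1) a s` (X1-Q3b part 2) re-indexed along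
  `Site 4 s × Unit → Site 4 s` — so §1's letter is the owner's `Ghat_mul_AXhat` in TA3b's currency (NOT a new fact; re-derived here in one line by
  `lemma222F` to keep this file's letter self-contained), and K-TB3b-J's `Ghat`∕`Lhat`∕`Shat` algebra transfers to the ghost `hessT` terms.
* §2 [folklore] THE FINE-TORUS SOCKETS: along `σ_k = n·p_k`, `p_k → ∞`, `tr_T((Ggh)^·(arr W)^) → tadpole Ggh W`, the bubble twin, and
  `hessT((Ggh)^; (arr 𝒱 μ 0)^, (arr 𝒱 ν z)^, (arr 𝒲 μ 0 ν z)^) → hessKer (Ggh n a) 𝒱 𝒲 μ ν z` for bi-localised scalar families (TA3b at `F = Unit`,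
  `hA := decays_Ggh`, `hAper ⟸ shiftK_Ggh`).
* §3 (FILE 2) [our object] `KsqK n a`, `CsqK n a` = pv23's COARSE-lattice kernels `kerSq (n−1) a` (`Q′G′²Q′*`) and `Csq (n−1) a` («the
  operator C») read as `MKer 4 Unit`; [folklore] full translation invariance BY NAME from d1-formalise-leaf-05-g3's `RJetProjector`
  (`kerSq_translate`, `Csq_translate`), hence `shiftK t CsqK = CsqK` and joint `p`-periodicity for EVERY `p`; decay∕row bounds of both kernels in
  the road's `ℓ¹` currency; `compF (toF KsqK) (toF CsqK) = kdeltaF` (both orders) and THE COARSE-TORUS LETTER `periodiseF_KsqK_mul_CsqK` on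
  `Site 4 p × Unit` for every `p`, with uniqueness corollaries.
* §4 (FILE 2) [folklore] THE COARSE-TORUS SOCKETS for `(CsqK)^` along any `p_k → ∞`.
NOT IN EITHER FILE (K-TB3c PART 2, not claimed): the torus-side identification `Q̂′·((Ggh)^)²·Q̂′ᵀ = n⁴•(KsqK)^` (scalar twin of 3b-Q(ii)
`TorusAveragingGram`), the M-∕S-jets as periodised arrays of the END's ghost rows `PghQ` and of the unit-class Gram rows (dictionary of record,
after TB4-tables), and the sorted-currency re-indexing (`SortedEmbedding`) if TB5 wants it.
Provenance: NE9 formalisation swarm leaf seat `b2b-balaban-t4-ne9-formalise-leaf-09` gen 38 (cross-row prover duty NE9 → β∕D1 road «BF-x»; journal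
CLAIM + SHAPE l.22755), 2026-08-20.
-/

noncomputable section

namespace Summit.QuantumFields.BalabanUV.Beta.D1BFx.TorusGhostLegs

open Filter Topology
open scoped BigOperators
open Literature.MathematicalPhysics.QuantumFieldTheory.Balaban1983to89
open Literature.MathematicalPhysics.QuantumFieldTheory.Balaban1983to89.Beta
open B12Sec2to5 (l1)
open B6QGQLower276 (AX)
open B6QGQDecay237 (deltaU deltaU_pos)
open B5Hk103ScalarZd (nbhd AX_eq_zero_of_not_mem)
open ExpKernelCalculus (Site MKer Decays BiLoc comp bubble tadpole hessKer shiftK)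
open Summit.QuantumFields.BalabanUV.Beta.D1BFx.FibredPeriodisation (Kfib kdeltaF compF periodiseF lemma222F eq_periodiseF_of_mul_eq_one
  eq_periodiseF_of_mul_eq_one' periodiseF_transpose)
open Summit.QuantumFields.BalabanUV.Beta.D1BFx.PeriodicArrays (arr toF toF_apply Kfib_toF periodic_of_shiftK)
open Summit.QuantumFields.BalabanUV.Beta.D1BFx.MixedVarPackedHess (hessT)
open Summit.QuantumFields.BalabanUV.Beta.D1BFx.GhostLeg (Ggh decays_Ggh shiftK_Ggh Ggh_symm tsum_AX_mul_Ggh tsum_Ggh_mul_AX)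
open Summit.QuantumFields.BalabanUV.Beta.D1BFx.TorusTraceTadpole (tendsto_trace_tadpole tendsto_trace_bubble tendsto_hessT_hessKer
  periodiseF_toF_mul_arr)

/-! ## §1 The scalar tower operator and its leg on the fine torus -/

section TowerLeg

variable (n : ℕ) [NeZero n] (a : ℝ)

/-- [our object] **THE SCALAR TOWER OPERATOR AS A ROAD KERNEL**: `AXgh n a x y () () := AX (n − 1) a x y`, the site matrix
`n²·(−Δ_sites)(x,y) + a·n⁻⁴·1[blk x = blk y]` of `Δ^η + a·Q′*Q′` (`η = 1∕n`, block side `n`) on `ℤ⁴` (`B6QGQLower276.AX`,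
`GhostLeg.AX_pred_apply`) — the operator whose two-sided whole-lattice inverse kernel `GhostLeg.Ggh n a` IS.  A re-indexing; asserts nothing. -/
def AXgh : MKer 4 Unit := fun x y _ _ => AX (d := 4) (n - 1) a x y

omit [NeZero n] in
/-- [our object] Unfolding `AXgh`. -/
@[simp] theorem AXgh_apply (x y : Site 4) (u v : Unit) : AXgh n a x y u v = AX (d := 4) (n - 1) a x y := rfl

omit [NeZero n] in
/-- [folklore] The rows of `AXgh` are finitely supported (on `nbhd`), hence absolutely summable — the LEFT-factor hypothesis of
`FibredPeriodisation.lemma222F`. -/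
theorem summable_abs_row_AXgh (u v : Unit) (x : Site 4) : Summable fun y : Site 4 => |Kfib (toF (AXgh n a)) u v x y| := by
  refine summable_of_ne_finset_zero (s := nbhd (n - 1) x) fun y hy => ?_
  simp only [Kfib_toF, AXgh_apply, AX_eq_zero_of_not_mem a hy, abs_zero]

/-- [folklore] **`(Δ^η + aQ′*Q′) ∘ Ggh = 𝟙` IN FIBRED-KERNEL FORM**: `compF (toF AXgh) (toF Ggh) = kdeltaF` (`GhostLeg.tsum_AX_mul_Ggh` BY NAME). -/
theorem compF_AXgh_Ggh (ha : 0 < a) : compF (toF (AXgh n a)) (toF (Ggh n a)) = kdeltaF := by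
  funext i j
  obtain ⟨x, u⟩ := i
  obtain ⟨y, v⟩ := j
  simp only [compF, toF_apply, AXgh_apply, Finset.univ_unique, Finset.sum_singleton, kdeltaF, Prod.mk.injEq]
  rw [tsum_AX_mul_Ggh n a ha x y]
  by_cases h : x = y
  · simp [h]
  · simp [h]

/-- [folklore] **`Ggh ∘ (Δ^η + aQ′*Q′) = 𝟙` IN FIBRED-KERNEL FORM** (`GhostLeg.tsum_Ggh_mul_AX` BY NAME). -/
theorem compF_Ggh_AXgh (ha : 0 < a) : compF (toF (Ggh n a)) (toF (AXgh n a)) = kdeltaF := by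
  funext i j
  obtain ⟨x, u⟩ := i
  obtain ⟨y, v⟩ := j
  simp only [compF, toF_apply, AXgh_apply, Finset.univ_unique, Finset.sum_singleton, kdeltaF, Prod.mk.injEq]
  rw [tsum_Ggh_mul_AX n a ha x y]
  by_cases h : x = y
  · simp [h]
  · simp [h]

/-- [folklore] **JOINT PERIODICITY OF THE GHOST LEG**: `Ggh n a (x + s·t) (y + s·t) = Ggh n a x y` whenever `n ∣ s` (block-translation
covariance `GhostLeg.shiftK_Ggh`). -/
theorem Ggh_imageShift (ha : 0 < a) {s : ℕ} (hdiv : n ∣ s) (x y t : Site 4) (u v : Unit) :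
    Ggh n a (imageShift s x t) (imageShift s y t) u v = Ggh n a x y u v := by
  obtain ⟨q, rfl⟩ := hdiv
  refine periodic_of_shiftK (fun t' => ?_) x y t u v
  have e : ((n * q : ℕ) : ℤ) • t' = (n : ℤ) • ((q : ℤ) • t') := by
    rw [Nat.cast_mul, mul_smul]
  rw [e]
  exact shiftK_Ggh n a ha _

/-- [folklore] … in an4's vocabulary: every fibre of `toF (Ggh n a)` is `IsPeriodic₂ s` for `n ∣ s`. -/
theorem isPeriodic₂_Ggh (ha : 0 < a) {s : ℕ} (hdiv : n ∣ s) (u v : Unit) : IsPeriodic₂ s (Kfib (toF (Ggh n a)) u v) :=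
  fun x y t => Ggh_imageShift n a ha hdiv x y t u v

/-- [folklore] A UNIFORM `ℓ¹` ROW BOUND for the fibres of the ghost leg, from `GhostLeg.decays_Ggh`. -/
theorem rowBound_Ggh (ha : 0 < a) (u v : Unit) :
    RowBound (Kfib (toF (Ggh n a)) u v) (2 / min 2 a * ∑' w : Site 4, Real.exp (-(deltaU 4 a / (4 * n)) * l1 w)) := by
  have h2 : Decay₂ (Kfib (toF (Ggh n a)) u v) (2 / min 2 a) (deltaU 4 a / (4 * n)) := fun x y => by
    rw [Kfib_toF]; exact decays_Ggh n a ha x y u v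
  exact h2.rowBound (div_pos (deltaU_pos 4 ha) (mul_pos four_pos (Nat.cast_pos.2 (Nat.pos_of_ne_zero (NeZero.ne n)))))

variable {s : ℕ} [NeZero s]

/-- [folklore] **THE FINE-TORUS LETTER OF THE GHOST LEG** (Lemma 2.2.2 for the scalar tower): on every fine torus `Site 4 s` with `n ∣ s`,
`(AXgh)^ · (Ggh)^ = 1` AND `(Ggh)^ · (AXgh)^ = 1` — the periodised ghost leg IS the torus inverse of the periodised tower operator
`Δ^η + a·Q′*Q′` (`FibredPeriodisation.lemma222F` on `compF_AXgh_Ggh`). -/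
theorem periodiseF_AXgh_mul_Ggh (ha : 0 < a) (hdiv : n ∣ s) :
    Matrix.of (periodiseF s (toF (AXgh n a))) * Matrix.of (periodiseF s (toF (Ggh n a))) = 1 ∧
      Matrix.of (periodiseF s (toF (Ggh n a))) * Matrix.of (periodiseF s (toF (AXgh n a))) = 1 :=
  lemma222F (summable_abs_row_AXgh n a) (isPeriodic₂_Ggh n a ha hdiv) (rowBound_Ggh n a ha) (compF_AXgh_Ggh n a ha)

/-- [folklore] **UNIQUENESS, RIGHT FORM**: any right inverse of `(AXgh)^` on the torus is `(Ggh)^`. -/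
theorem eq_periodiseF_Ggh_of_mul_eq_one (ha : 0 < a) (hdiv : n ∣ s) {G : Matrix (Site 4 s × Unit) (Site 4 s × Unit) ℝ}
    (hG : Matrix.of (periodiseF s (toF (AXgh n a))) * G = 1) : G = Matrix.of (periodiseF s (toF (Ggh n a))) :=
  eq_periodiseF_of_mul_eq_one (summable_abs_row_AXgh n a) (isPeriodic₂_Ggh n a ha hdiv) (rowBound_Ggh n a ha)
    (compF_AXgh_Ggh n a ha) hG

/-- [folklore] **UNIQUENESS, LEFT FORM**: any left inverse of `(AXgh)^` on the torus is `(Ggh)^`. -/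
theorem eq_periodiseF_Ggh_of_mul_eq_one' (ha : 0 < a) (hdiv : n ∣ s) {G : Matrix (Site 4 s × Unit) (Site 4 s × Unit) ℝ}
    (hG : G * Matrix.of (periodiseF s (toF (AXgh n a))) = 1) : G = Matrix.of (periodiseF s (toF (Ggh n a))) :=
  eq_periodiseF_of_mul_eq_one' (summable_abs_row_AXgh n a) (isPeriodic₂_Ggh n a ha hdiv) (rowBound_Ggh n a ha)
    (compF_AXgh_Ggh n a ha) hG

/-- [folklore] The periodised tower operator is invertible on the torus (`IsUnit` of its determinant). -/
theorem isUnit_det_periodiseF_AXgh (ha : 0 < a) (hdiv : n ∣ s) : IsUnit (Matrix.of (periodiseF s (toF (AXgh n a)))).det :=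
  Matrix.isUnit_det_of_right_inverse (periodiseF_AXgh_mul_Ggh n a ha hdiv).1

/-- [folklore] … hence `((AXgh)^)⁻¹ = (Ggh)^` as a matrix inverse. -/
theorem inv_periodiseF_AXgh (ha : 0 < a) (hdiv : n ∣ s) :
    (Matrix.of (periodiseF s (toF (AXgh n a))))⁻¹ = Matrix.of (periodiseF s (toF (Ggh n a))) :=
  Matrix.inv_eq_right_inv (periodiseF_AXgh_mul_Ggh n a ha hdiv).1

/-- [folklore] **SYMMETRY OF THE PERIODISED GHOST LEG**: `(Ggh)^ᵀ = (Ggh)^` (`GhostLeg.Ggh_symm` + the fibred transpose rule). -/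
theorem periodiseF_Ggh_transpose (ha : 0 < a) (hdiv : n ∣ s) :
    (Matrix.of (periodiseF s (toF (Ggh n a)))).transpose = Matrix.of (periodiseF s (toF (Ggh n a))) := by
  ext ⟨x, u⟩ ⟨y, v⟩
  rw [Matrix.transpose_apply, Matrix.of_apply, Matrix.of_apply]
  have e : toF (Ggh n a) = fun i j => toF (Ggh n a) j i := by
    funext i j
    obtain ⟨x', u'⟩ := i
    obtain ⟨y', v'⟩ := j
    rw [toF_apply, toF_apply]
    exact Ggh_symm n a ha x' y' u' v'
  conv_lhs => rw [e]
  exact periodiseF_transpose (isPeriodic₂_Ggh n a ha hdiv) x y u v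

/-! ### §1b Bridge to the owner's unfibred torus matrices (`PeriodisedProjector.Ghat`∕`AXhat`, X1-Q3b part 2) -/

/-- [folklore] **CURRENCY BRIDGE, LEG**: the fibred periodisation of the ghost leg IS the owner's torus matrix `Ghat (n − 1) a s` re-indexed along
`Site 4 s × Unit → Site 4 s` (both are `periodise₂ s (Gk (n−1) a)` entrywise) — so §1's letter is `PeriodisedProjector.Ghat_mul_AXhat` in TA3b's
`Matrix.of (periodiseF s (toF ·))` currency, and K-TB3b-J's `Ghat`∕`Lhat`∕`Shat` algebra transfers to the ghost `hessT` terms by `submatrix`. -/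
theorem periodiseF_Ggh_eq_submatrix :
    Matrix.of (periodiseF s (toF (Ggh n a))) = (PeriodisedProjector.Ghat (n - 1) a s).submatrix Prod.fst Prod.fst := by
  ext ⟨x, u⟩ ⟨y, v⟩
  rfl

omit [NeZero n] in
/-- [folklore] **CURRENCY BRIDGE, OPERATOR**: `(AXgh)^` IS the owner's `AXhat (n − 1) a s` re-indexed along `Prod.fst` (hence, by
`PeriodisedProjector.AXhat_eq`, `= n²•L̂ + (a∕n⁴)•Ŝ` re-indexed — the normalisation K-TB3b-J matches against `Dhat`). -/
theorem periodiseF_AXgh_eq_submatrix :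
    Matrix.of (periodiseF s (toF (AXgh n a))) = (PeriodisedProjector.AXhat (n - 1) a s).submatrix Prod.fst Prod.fst := by
  ext ⟨x, u⟩ ⟨y, v⟩
  rfl

/-- [folklore] The same bridge read backwards: the owner's `Ghat` is the fibred periodisation re-indexed along the (inverse) equivalence
`Site 4 s ≃ Site 4 s × Unit` (`Equiv.prodPUnit`), so either currency's letter implies the other's. -/
theorem Ghat_eq_submatrix_periodiseF :
    PeriodisedProjector.Ghat (n - 1) a s = (Matrix.of (periodiseF s (toF (Ggh n a)))).submatrix (fun x => (x, ())) (fun y => (y, ())) := by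
  ext x y
  rfl

end TowerLeg

/-! ## §2 The fine-torus sockets of the ghost leg: torus one-loop functionals → `ℤ⁴` functionals (TA3b at `F = Unit`) -/

section TowerSockets

variable (n : ℕ) [NeZero n] (a : ℝ) {V V' W : MKer 4 Unit} {P Q P' Q' : Site 4} {C Cv Cv' δ : ℝ} {p : ℕ → ℕ} [∀ k, NeZero (p k)]

omit [∀ k, NeZero (p k)] in
/-- [folklore] `p k → ∞ ⟹ n · p k → ∞`. -/
theorem tendsto_mul_period (hp : Tendsto p atTop atTop) : Tendsto (fun k => n * p k) atTop atTop :=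
  Filter.tendsto_atTop_mono (fun k => Nat.le_mul_of_pos_left (p k) (Nat.pos_of_ne_zero (NeZero.ne n))) hp

omit [∀ k, NeZero (p k)] in
/-- [folklore] The `hAper` hypothesis of TA3b for the ghost leg along the fine periods `n · p k` (nondegenerate tori: `NeZero (n * p k)` is
Mathlib's `NeZero.mul`). -/
theorem Ggh_imageShift_mul (ha : 0 < a) (k : ℕ) (x y t : Site 4) (u v : Unit) :
    Ggh n a (imageShift (n * p k) x t) (imageShift (n * p k) y t) u v = Ggh n a x y u v :=
  Ggh_imageShift n a ha (Dvd.intro (p k) rfl) x y t u v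

/-- [folklore] **THE TORUS PRODUCT RULE FOR THE GHOST LEG**: `(Ggh)^ · (arr s W)^ = (arr s (Ggh ∘ W))^` on every fine torus `Site 4 s`, `n ∣ s`
(TA3b `periodiseF_toF_mul_arr`; the rule K-TB3c PART 2 iterates for the S-jets). -/
theorem periodiseF_Ggh_mul_arr (ha : 0 < a) {s : ℕ} [NeZero s] (hdiv : n ∣ s) (hW : BiLoc W P Q C δ) (hδ : 0 < δ) :
    Matrix.of (periodiseF s (toF (Ggh n a))) * Matrix.of (periodiseF s (toF (arr s W))) =
      Matrix.of (periodiseF s (toF (arr s (comp (Ggh n a) W)))) :=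
  periodiseF_toF_mul_arr (decays_Ggh n a ha)
    (div_pos (deltaU_pos 4 ha) (mul_pos four_pos (Nat.cast_pos.2 (Nat.pos_of_ne_zero (NeZero.ne n)))))
    (fun x y t u v => Ggh_imageShift n a ha hdiv x y t u v) hW hδ

/-- [folklore] **GHOST TADPOLE SOCKET**: along the fine tori `Site 4 (n·p k)`, `p k → ∞`, `tr_T((Ggh)^ · (arr W)^) → tadpole (Ggh n a) W` for every
scalar vertex `W` bi-localised at `(P, Q)`. -/
theorem tendsto_trace_tadpole_Ggh (ha : 0 < a) (hW : BiLoc W P Q C δ) (hδ : 0 < δ) (hp : Tendsto p atTop atTop) :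
    Tendsto (fun k => Matrix.trace (Matrix.of (periodiseF (n * p k) (toF (Ggh n a))) *
        Matrix.of (periodiseF (n * p k) (toF (arr (n * p k) W))))) atTop (𝓝 (tadpole (Ggh n a) W)) :=
  tendsto_trace_tadpole (σ := fun k => n * p k) (decays_Ggh n a ha)
    (div_pos (deltaU_pos 4 ha) (mul_pos four_pos (Nat.cast_pos.2 (Nat.pos_of_ne_zero (NeZero.ne n)))))
    (Ggh_imageShift_mul n a ha) hW hδ (tendsto_mul_period n hp)

/-- [folklore] **GHOST BUBBLE SOCKET**: `tr_T(((Ggh)^(arr V)^)((Ggh)^(arr V′)^)) → bubble (Ggh n a) V V′`. -/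
theorem tendsto_trace_bubble_Ggh (ha : 0 < a) (hV : BiLoc V P P' Cv δ) (hV' : BiLoc V' Q' Q Cv' δ) (hδ : 0 < δ)
    (hp : Tendsto p atTop atTop) :
    Tendsto (fun k => Matrix.trace (Matrix.of (periodiseF (n * p k) (toF (Ggh n a))) *
        Matrix.of (periodiseF (n * p k) (toF (arr (n * p k) V))) *
        (Matrix.of (periodiseF (n * p k) (toF (Ggh n a))) * Matrix.of (periodiseF (n * p k) (toF (arr (n * p k) V'))))))
      atTop (𝓝 (bubble (Ggh n a) V V')) :=
  tendsto_trace_bubble (σ := fun k => n * p k) (decays_Ggh n a ha)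
    (div_pos (deltaU_pos 4 ha) (mul_pos four_pos (Nat.cast_pos.2 (Nat.pos_of_ne_zero (NeZero.ne n)))))
    (Ggh_imageShift_mul n a ha) hV hV' hδ (tendsto_mul_period n hp)

/-- [folklore] **THE GHOST HESS SOCKET — THE POINT OF §2**: for scalar base-point families `𝒱` (first jets `𝒱 μ 0`, `𝒱 ν z`) and `𝒲` (mixed second
jet `𝒲 μ 0 ν z`) bi-localised at a common rate, the torus one-loop functional of the periodised ghost leg against the periodised arrays converges,
along the fine tori `Site 4 (n·p k)` with `p k → ∞`, to the `ℤ⁴` resolvent Hessian kernel of the ghost leg: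
`hessT (Ggh)^ (arr (𝒱 μ 0))^ (arr (𝒱 ν z))^ (arr (𝒲 μ 0 ν z))^ → hessKer (Ggh n a) 𝒱 𝒲 μ ν z` (TA3b `tendsto_hessT_hessKer` at `F = Unit`). -/
theorem tendsto_hessT_Ggh (ha : 0 < a) (𝒱 : Fin 4 → Site 4 → MKer 4 Unit) (𝒲 : Fin 4 → Site 4 → Fin 4 → Site 4 → MKer 4 Unit)
    (μ ν : Fin 4) (z : Site 4) (hV : BiLoc (𝒱 μ 0) P P' Cv δ) (hV' : BiLoc (𝒱 ν z) Q' Q Cv' δ) (hW : BiLoc (𝒲 μ 0 ν z) P Q C δ)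
    (hδ : 0 < δ) (hp : Tendsto p atTop atTop) :
    Tendsto (fun k => hessT (Matrix.of (periodiseF (n * p k) (toF (Ggh n a))))
        (Matrix.of (periodiseF (n * p k) (toF (arr (n * p k) (𝒱 μ 0)))))
        (Matrix.of (periodiseF (n * p k) (toF (arr (n * p k) (𝒱 ν z)))))
        (Matrix.of (periodiseF (n * p k) (toF (arr (n * p k) (𝒲 μ 0 ν z))))))
      atTop (𝓝 (hessKer (Ggh n a) 𝒱 𝒲 μ ν z)) :=
  tendsto_hessT_hessKer (σ := fun k => n * p k) (decays_Ggh n a ha)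
    (div_pos (deltaU_pos 4 ha) (mul_pos four_pos (Nat.cast_pos.2 (Nat.pos_of_ne_zero (NeZero.ne n)))))
    (Ggh_imageShift_mul n a ha) 𝒱 𝒲 μ ν z hV hV' hW hδ (tendsto_mul_period n hp)

end TowerSockets

end Summit.QuantumFields.BalabanUV.Beta.D1BFx.TorusGhostLegs

end
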